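import Mathlib
import HarnessLib
import Summits.HubbardSuperconductivity.HubbardSuperconductivity.Theorems.KLProgrammeKLRegimeSplitTwoLegCoreTDZero
import Summits.HubbardSuperconductivity.HubbardSuperconductivity.Theorems.KLProgrammeKLRegimeEngineV8DefsG5

/-!
# Route `KLProgramme` — GEN-6 two-leg slot (`klPredsV15`): the CAPPED (E3c) at scale `n + 1` — increment responses against CAPPED comparison frames only

Cell `gate-hubbard-kl`, seat p1b (g7).  `twoLegCoreTD_succ_of_momentumSizes[_stub6]` (`…TwoLegCoreTDZero` / `…Stub6`) still take the increment response
`ρ_Δ` over the RAW class `FrameOK … K'` (the V14 shape) and weaken afterwards.  Under the cap the engine owes the response only for CAPPED `K'`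
(`FrameLipschitzFnTD`), and the raw shape is likely undischargeable for the same reason as at scale `0` (terms with an explicit `𝒩_{K−K'}` vertex:
pinned `ℓ¹` norms scale with the coefficient norm of `K − K'`, memo SCALE0-TWOLEG-EXPORTS.md v6).  So, the capped-native step closers:

* **`frameLipschitzFnTD_succ_of_increment_responses`** — `FrameLipschitzFnTD … K (n+1)` from the increment gradient `b_Δ` and a response modulus `ρ_Δ`
  against CAPPED `K'` with history, fit `ρ_Δ + b_Δ/klCurveD ≤ lipBar G Q U (n+1)`;
* **`twoLegCoreTD_succ_of_momentumSizes_degCap`** (named thresholds) / **`_stub6'`** (gen-6 literal binders, `klEngGeo5`/`klEngQ5`) — `TwoLegCoreTD … K (n+1)`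
  from the increment's momentum-side sizes, the CAPPED response, the K-separated gradient of `S_{n+1}` (no aliasing: capped frame, engine volume),
  the field strength on the shell, fits.

Proofs only; nothing about the model is asserted.  References: BGM 2006 §2.4 (2.36) [cite: BenfattoGiulianiMastropietro2006].
-/

noncomputable section

namespace Summit.HubbardSuperconductivity.HubbardSuperconductivity.Theorems.KLRegimeSplit

set_option linter.dupNamespace false -- summit = problem name (single-conjunct summit), D-0017

open Real Finset
open Literature.MathematicalPhysics.QuantumLattice Literature.MathematicalPhysics.QuantumLattice.BandSectorCounting
open Literature.Probability.LatticeModels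
open Summit.HubbardSuperconductivity.HubbardSuperconductivity.Theorems.DispersionFlow
open Summit.HubbardSuperconductivity.HubbardSuperconductivity.Theorems.PerturbedFermiCurve
open Summit.HubbardSuperconductivity.HubbardSuperconductivity.Theorems.KLProgrammeLegKernels
open Summit.HubbardSuperconductivity.HubbardSuperconductivity.Theorems.TwoLegFourier
open Summit.HubbardSuperconductivity.HubbardSuperconductivity.Theorems.EngineV8

variable {L M : ℕ} [NeZero L] [NeZero M]

/-- **Capped (E3c) for `ℓ_{n+1}`, NAMED thresholds**: increment gradient `b_Δ`, response modulus `ρ_Δ` against every CAPPED admissible `K′` with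
history, fit `ρ_Δ + b_Δ/klCurveD ≤ lipBar G Q U (n+1)` ⇒ `FrameLipschitzFnTD … K (n+1)`. -/
theorem frameLipschitzFnTD_succ_of_increment_responses {R : RenConsts} (hR : ∀ j, 0 ≤ R.Gfr j) {c : ℝ} (hc : 0 < c)
    (hcle : c ≤ klCurveC3 R) {U : ℝ} (hU : 0 < U) (hUle : U ≤ klCurveU0 R) {β : ℝ} (hβmin : klBetaMin ≤ β)
    (hβc : β ≤ Real.exp (c / U ^ 2)) {μ : ℝ} (hμ : μ ∈ klWindowC) {K : TrigPolyC4v} (hK : FrameOK R U (nScales β) μ K)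
    (hist : TrigPolyC4v → ℕ → Prop) (G : GeoConsts) (Q : EngConsts) (n : ℕ) {bΔ ρΔ : ℝ} (hbΔ : 0 ≤ bΔ)
    (hg : ∀ q : Momentum, ‖fderiv ℝ (fun q : Momentum =>
      evalM (symInterp L (klLocSelfEnergyRe L M β U μ K (n + 1))) q - evalM (symInterp L (klLocSelfEnergyRe L M β U μ K n)) q) q‖ ≤ bΔ)
    (hr : ∀ K' : TrigPolyC4v, FrameOKDeg R U (klTempScaleIdx β klE0) μ K' → (∀ j < n + 1, hist K' j) → ∀ θ : ℝ,
      |((symInterp L (klLocSelfEnergyRe L M β U μ K (n + 1))).eval (klFermiPoint μ K' θ) -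
          (symInterp L (klLocSelfEnergyRe L M β U μ K n)).eval (klFermiPoint μ K' θ)) -
        ((symInterp L (klLocSelfEnergyRe L M β U μ K' (n + 1))).eval (klFermiPoint μ K' θ) -
          (symInterp L (klLocSelfEnergyRe L M β U μ K' n)).eval (klFermiPoint μ K' θ))| ≤ ρΔ * frameDist K K')
    (hfit : ρΔ + bΔ / klCurveD ≤ lipBar G Q U (n + 1)) :
    FrameLipschitzFnTD L M hist G Q R β U μ K (n + 1) := by
  intro K' hK' hhist q
  have ha : (-4 : ℝ) < -1.1 := by norm_num
  have hab : (-1.1 : ℝ) ≤ -0.1 := by norm_num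
  have hb : (-0.1 : ℝ) < 0 := by norm_num
  obtain ⟨hAf, hA20, hADt, hhalf, ⟨hlo, hhi⟩, -, -⟩ := frame_sizes_of_frameOK_explicit hR hc hcle hU hUle hβmin hβc hμ hK
  obtain ⟨hAf', -, -, -, -, -, -⟩ := frame_sizes_of_frameOK_explicit hR hc hcle hU hUle hβmin hβc hμ hK'.1
  set A := 2 * R.Gfr 0 * |U| + 2 * R.Gfr 1 * U ^ 2 + R.Gfr 2 * (c / Real.log 4) with hAdef
  have hA0 : 0 ≤ A := le_trans (norm_nonneg _) (hAf 0 0 (by norm_num))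
  have hbd := abs_klTwoLegPieceFn_eval_succ_sub_le_sharp (bandBounds ha hab hb) hAf hAf' hADt hlo hhi hbΔ hg (hr K' hK' hhist) q
  have hfd : 0 ≤ frameDist K K' := frameDist_nonneg K K'
  have hDpos : 0 < klCurveD := by unfold klCurveD; linarith [cDtmin_window_ge]
  have hden : frameDist K K' / ((bandBounds ha hab hb).Dtmin - A) ≤ frameDist K K' / klCurveD :=
    div_le_div_of_nonneg_left hfd hDpos (by linarith)
  have h1 : ρΔ * frameDist K K' + bΔ * (frameDist K K' / klCurveD) = (ρΔ + bΔ / klCurveD) * frameDist K K' := by ring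
  calc _ ≤ ρΔ * frameDist K K' + bΔ * (frameDist K K' / ((bandBounds ha hab hb).Dtmin - A)) := hbd
    _ ≤ ρΔ * frameDist K K' + bΔ * (frameDist K K' / klCurveD) := by nlinarith [mul_le_mul_of_nonneg_left hden hbΔ]
    _ = (ρΔ + bΔ / klCurveD) * frameDist K K' := h1
    _ ≤ lipBar G Q U (n + 1) * frameDist K K' := mul_le_mul_of_nonneg_right hfit hfd

/-- **`TwoLegCoreTD … K (n+1)` for a CAPPED frame at an engine volume, CAPPED response, NAMED thresholds.** -/
theorem twoLegCoreTD_succ_of_momentumSizes_degCap {R : RenConsts} (hR : ∀ j, 0 ≤ R.Gfr j) {c : ℝ} (hc : 0 < c)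
    (hcle : c ≤ klCurveC3 R) {U : ℝ} (hU : 0 < U) (hUle : U ≤ klCurveU0 R) {β : ℝ} (hβmin : klBetaMin ≤ β)
    (hβc : β ≤ Real.exp (c / U ^ 2)) {μ : ℝ} (hμ : μ ∈ klWindowC) {K : TrigPolyC4v} (hKD : FrameOKDeg R U (nScales β) μ K)
    (hL : klEngL₃ β U ≤ L) (hist : TrigPolyC4v → ℕ → Prop) (G : GeoConsts) (P : SplitConsts) (Q : EngConsts) (n : ℕ)
    {Mv : ℕ → ℝ}
    (hM : ∀ k ≤ 2, ∀ p : Momentum, ‖iteratedFDeriv ℝ k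
      (evalM (symInterp L fun q => klLocSelfEnergyRe L M β U μ K (n + 1) q - klLocSelfEnergyRe L M β U μ K n q)) p‖ ≤ Mv k)
    (hfitS : ∀ j ≤ 2, (if j = 0 then Mv 0 else 0) +
      (j.factorial : ℝ) ^ 2 * (2 * j.factorial * 1110 * 200 ^ j) *
        (if j = 0 then 2 * Mv 0 else (2 * π + 1) * (Mv 1 * klCurveD1) + (if j = 2 then Mv 2 * klCurveD1 ^ 2 + Mv 1 * klCurveD2 else 0)) *
        (4 + max 1 (((j - 1).factorial : ℝ) / (8 / 5))) ^ j ≤ twoLegBar G Q U j (n + 1))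
    {ρΔ : ℝ}
    (hr : ∀ K' : TrigPolyC4v, FrameOKDeg R U (klTempScaleIdx β klE0) μ K' → (∀ j < n + 1, hist K' j) → ∀ θ : ℝ,
      |((symInterp L (klLocSelfEnergyRe L M β U μ K (n + 1))).eval (klFermiPoint μ K' θ) -
          (symInterp L (klLocSelfEnergyRe L M β U μ K n)).eval (klFermiPoint μ K' θ)) -
        ((symInterp L (klLocSelfEnergyRe L M β U μ K' (n + 1))).eval (klFermiPoint μ K' θ) -
          (symInterp L (klLocSelfEnergyRe L M β U μ K' n)).eval (klFermiPoint μ K' θ))| ≤ ρΔ * frameDist K K')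
    (hfitL : ρΔ + Mv 1 / klCurveD ≤ lipBar G Q U (n + 1))
    {m₁' : ℝ}
    (hm₁' : ∀ p : Momentum, ‖iteratedFDeriv ℝ 1
      (evalM (symInterp L (fun q => klLocSelfEnergyRe L M β U μ K (n + 1) q - K.eval (latticeMomentum L q)))) p‖ ≤ m₁')
    (hz : ∀ k ∈ klShell L μ K (n + 1), |klFieldStrength L M β U μ K (n + 1) k - 1| ≤ R.cz * |U|)
    (hfit1 : m₁' + 4 / 3 * R.Gfr 1 * U ^ 2 ≤ R.cz * |U| * (cDtmin (-1.2) (-0.05) / 2)) :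
    TwoLegCoreTD L M hist G P Q R β U μ K (n + 1) := by
  have hK : FrameOK R U (nScales β) μ K := hKD.1
  have hdeg : K.degree ≤ L / 2 := hKD.degree_le_half rfl hβmin hL
  have ha₁ : ∀ p : Momentum, ‖iteratedFDeriv ℝ 1
      (fun p : Momentum => evalM (symInterp L (fun q => K.eval (latticeMomentum L q))) p - evalM K p) p‖ ≤ 0 := fun p => by
    rw [iteratedFDeriv_symInterp_latticeValues_sub_eq_zero L K hdeg 1 p, norm_zero]
  have ha' : (-4 : ℝ) < -1.1 := by norm_num
  have hab : (-1.1 : ℝ) ≤ -0.1 := by norm_num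
  have hb : (-0.1 : ℝ) < 0 := by norm_num
  obtain ⟨hAf, hA20, hADt, -, ⟨hlo, hhi⟩, -, -⟩ := frame_sizes_of_frameOK_explicit hR hc hcle hU hUle hβmin hβc hμ hK
  have hνC : ∀ k : ℕ, ContDiff ℝ 4 (klLocalPart L M β U μ K k) := fun k =>
    contDiff_klLocalPart (bandBounds ha' hab hb) hAf hADt hlo hhi L M β U k
  have hgΔ : ∀ q : Momentum, ‖fderiv ℝ (fun q : Momentum =>
      evalM (symInterp L (klLocSelfEnergyRe L M β U μ K (n + 1))) q - evalM (symInterp L (klLocSelfEnergyRe L M β U μ K n)) q) q‖ ≤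
      Mv 1 := fun q => by
    have hfun : (fun q : Momentum =>
        evalM (symInterp L (klLocSelfEnergyRe L M β U μ K (n + 1))) q - evalM (symInterp L (klLocSelfEnergyRe L M β U μ K n)) q) =
        evalM (symInterp L fun k => klLocSelfEnergyRe L M β U μ K (n + 1) k - klLocSelfEnergyRe L M β U μ K n k) := by
      funext q; simp only [evalM_apply, eval_symInterp_sub]
    rw [hfun, ← norm_iteratedFDeriv_one]
    exact hM 1 (by norm_num) q
  have hMv10 : 0 ≤ Mv 1 := (norm_nonneg _).trans (hgΔ 0)
  refine ⟨⟨?_, fun j hj q => ?_⟩, ?_, ?_⟩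
  · have hP := klTwoLegPieceFn_eval_succ (L := L) (M := M) β U μ K n (hνC (n + 1)).continuous (hνC n).continuous
    have hδ : ContDiff ℝ (4 : ℕ∞) (fun θ => klLocalPart L M β U μ K (n + 1) θ - klLocalPart L M β U μ K n θ) := by
      exact_mod_cast (hνC (n + 1)).sub (hνC n)
    have hper : Function.Periodic (fun θ => klLocalPart L M β U μ K (n + 1) θ - klLocalPart L M β U μ K n θ) (2 * π) := fun θ => by
      simp only [klLocalPart_periodic β U μ K (n + 1) θ, klLocalPart_periodic β U μ K n θ]
    exact_mod_cast contDiff_onM_piece hP hδ hper hμ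
  · exact (twoLegPieceV13_tier1_size_le_sep (L := L) (M := M) hR hc hcle hU hUle hβmin hβc hμ hK n hM hj
      (fun l hl x => norm_iteratedFDeriv_salmhoferCutoff_le_of_le_two (hl.trans hj) x) q).trans (hfitS j hj)
  · exact frameLipschitzFnTD_succ_of_increment_responses (L := L) (M := M) hR hc hcle hU hUle hβmin hβc hμ hK hist G Q n hMv10 hgΔ hr hfitL
  · have haw : (-4 : ℝ) < -1.2 := by norm_num
    have habw : (-1.2 : ℝ) ≤ -0.05 := by norm_num
    have hbw : (-0.05 : ℝ) < 0 := by norm_num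
    set B := bandBounds haw habw hbw with hBdef
    have hBD : B.Dtmin = cDtmin (-1.2) (-0.05) := rfl
    have hAfw : ∀ p : Momentum, ∀ j ≤ 2, ‖iteratedFDeriv ℝ j (frameShift K) p‖ ≤
        2 * R.Gfr 0 * |U| + 2 * R.Gfr 1 * U ^ 2 + R.Gfr 2 * (c / Real.log 4) := fun p j hj =>
      norm_iteratedFDeriv_frameShift_le_of_frameOK_regime hR hc.le hβmin hβc hK p hj
    obtain ⟨hA20w, hADtw, hhalf⟩ := two_frameSize_lt_cDtmin_wide hR hc.le hcle hU hUle
    have hADt' : 2 * (2 * R.Gfr 0 * |U| + 2 * R.Gfr 1 * U ^ 2 + R.Gfr 2 * (c / Real.log 4)) < B.Dtmin := by rw [hBD]; exact hADtw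
    obtain ⟨hloΛ, hhiΛ⟩ := klWindowC_shell_margin hμ hA20w (klScale_klE0_le_klE0 (n + 1))
    have h13 : 0 ≤ 4 / 3 * R.Gfr 1 * U ^ 2 := by have := hR 1; positivity
    have hm0 : 0 ≤ m₁' := (norm_nonneg _).trans (hm₁' 0)
    have hczU : 0 ≤ R.cz * |U| := by
      by_contra hneg
      have hneg' : R.cz * |U| < 0 := lt_of_not_ge hneg
      have : R.cz * |U| * (cDtmin (-1.2) (-0.05) / 2) < 0 := mul_neg_of_neg_of_pos hneg' (by linarith [cDtmin_wide_ge])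
      linarith
    set bS : ℝ := m₁' + 4 / 3 * R.Gfr 1 * U ^ 2 with hbS
    have hbS0 : 0 ≤ bS := by positivity
    have hgradS : ∀ q : Momentum, ‖fderiv ℝ (evalM (symInterp L (klLocSelfEnergyRe L M β U μ K (n + 1)))) q‖ ≤ bS := fun q => by
      have h := norm_fderiv_evalM_twoLegPoly_le_sep (L := L) (M := M) hm₁' ha₁ q
      rw [add_zero] at h
      exact h.trans (by rw [hbS]; linarith [norm_iteratedFDeriv_one_frameShift_le_of_frameOK hR hK q])
    have hb' : bS ≤ R.cz * |U| * (B.Dtmin - 2 * (2 * R.Gfr 0 * |U| + 2 * R.Gfr 1 * U ^ 2 + R.Gfr 2 * (c / Real.log 4))) :=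
      hfit1.trans (mul_le_mul_of_nonneg_left (by rw [hBD]; exact hhalf) hczU)
    exact twoLegSlopes_of_fieldStrength_of_gradient B hAfw hADt' hloΛ hhiΛ (selfEnergySymmetric_all L M β U μ K (n + 1)) hz hbS0
      hgradS hb'

/-- **Gen-6 stub-keyed, scale `n + 1`, CAPPED response** (`stub_twoLeg_step`'s literal binders): `TwoLegCoreTD L M hist klEngGeo5 P (klEngQ5 P R) R β U μ K (n+1)`. -/
theorem twoLegCoreTD_succ_of_momentumSizes_stub6' (P : SplitConsts) {R : RenConsts} (hRW : R.WF2) {c : ℝ} (hc : 0 < c)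
    (hcle : c ≤ klEngC₃3 P R) {U : ℝ} (hU : 0 < U) (hUle : U ≤ klEngU₀3 P R c) {β : ℝ} (hβmin : klBetaMin ≤ β)
    (hβc : β ≤ Real.exp (c / U ^ 2)) {μ : ℝ} (hμ : μ ∈ klWindowC) {K : TrigPolyC4v} (hKD : FrameOKDeg R U (nScales β) μ K)
    (hL : klEngL₃ β U ≤ L) (hist : TrigPolyC4v → ℕ → Prop) (n : ℕ) {Mv : ℕ → ℝ}
    (hM : ∀ k ≤ 2, ∀ p : Momentum, ‖iteratedFDeriv ℝ k
      (evalM (symInterp L fun q => klLocSelfEnergyRe L M β U μ K (n + 1) q - klLocSelfEnergyRe L M β U μ K n q)) p‖ ≤ Mv k)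
    (hfitS : ∀ j ≤ 2, (if j = 0 then Mv 0 else 0) +
      (j.factorial : ℝ) ^ 2 * (2 * j.factorial * 1110 * 200 ^ j) *
        (if j = 0 then 2 * Mv 0 else (2 * π + 1) * (Mv 1 * klCurveD1) + (if j = 2 then Mv 2 * klCurveD1 ^ 2 + Mv 1 * klCurveD2 else 0)) *
        (4 + max 1 (((j - 1).factorial : ℝ) / (8 / 5))) ^ j ≤ twoLegBar klEngGeo5 (klEngQ5 P R) U j (n + 1))
    {ρΔ : ℝ}
    (hr : ∀ K' : TrigPolyC4v, FrameOKDeg R U (klTempScaleIdx β klE0) μ K' → (∀ j < n + 1, hist K' j) → ∀ θ : ℝ,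
      |((symInterp L (klLocSelfEnergyRe L M β U μ K (n + 1))).eval (klFermiPoint μ K' θ) -
          (symInterp L (klLocSelfEnergyRe L M β U μ K n)).eval (klFermiPoint μ K' θ)) -
        ((symInterp L (klLocSelfEnergyRe L M β U μ K' (n + 1))).eval (klFermiPoint μ K' θ) -
          (symInterp L (klLocSelfEnergyRe L M β U μ K' n)).eval (klFermiPoint μ K' θ))| ≤ ρΔ * frameDist K K')
    (hfitL : ρΔ + Mv 1 / klCurveD ≤ lipBar klEngGeo5 (klEngQ5 P R) U (n + 1))
    {m₁' : ℝ}
    (hm₁' : ∀ p : Momentum, ‖iteratedFDeriv ℝ 1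
      (evalM (symInterp L (fun q => klLocSelfEnergyRe L M β U μ K (n + 1) q - K.eval (latticeMomentum L q)))) p‖ ≤ m₁')
    (hz : ∀ k ∈ klShell L μ K (n + 1), |klFieldStrength L M β U μ K (n + 1) k - 1| ≤ R.cz * |U|)
    (hfit1 : m₁' + 4 / 3 * R.Gfr 1 * U ^ 2 ≤ R.cz * |U| * (cDtmin (-1.2) (-0.05) / 2)) :
    TwoLegCoreTD L M hist klEngGeo5 P (klEngQ5 P R) R β U μ K (n + 1) :=
  have hR : ∀ j, 0 ≤ R.Gfr j := hRW.1.2.2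
  twoLegCoreTD_succ_of_momentumSizes_degCap (L := L) (M := M) hR hc (hcle.trans (klEngC₃3_le_klCurveC3 P hR)) hU
    (hUle.trans (klEngU₀3_le_klCurveU0 P hR c)) hβmin hβc hμ hKD hL hist klEngGeo5 P (klEngQ5 P R) n hM hfitS hr hfitL hm₁' hz hfit1

end Summit.HubbardSuperconductivity.HubbardSuperconductivity.Theorems.KLRegimeSplit

end
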